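/-
Copyright (c) 2026 the pub-hodgecm-mathlib formalisation cell (harness21).  Prover seat hodgecm-mathlib-F0P2-p06 (g13): road «S3-ram» (LEAD F0P3a-plan (g12); architect
A-p16 (g31); junction pen F0P3a-p01 (g17), J-PACK v2-iso socket S3; owner F0P3a-p06 (g15)); 2026-09-02.
-/
import Literature.NumberTheory.Automorphic.UnitaryLatticeTreeRootSliceCountRamified    -- ★ p847590 (this seat): ROW-ROOT-SLICE (brings ★ J6-mult p847357, G3⁺, G3, G1)
import Literature.NumberTheory.Automorphic.UnitaryLatticeTreeFixedRowEvenRamified      -- ★ p847526 (F0P2-p01): brings ★ K∕L∕H∕G∕F (child frame algebra, rev-symmetry at odd depth), ★ G3⁵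
import HarnessLib

/-!
# The lattice graph of a hermitian space — THE OFF-REGION SLICE COUNT AT A REGION VERTEX (J-PACK v2-iso socket S3 `row_offRegionSlice`): region membership of a far vertex
# is a function of the child's LINE, so `#{w ∈ GC(v) : w ∉ R, P w} = q · #{children c : the slice of c is off-region and P holds on it}` (Kottwitz 1986 §3; Bruhat–Tits 1972 §10)

Topic `NumberTheory/Automorphic`; namespace `Literature.NumberTheory.Automorphic.UnitaryLatticeTree`.  THEOREMS ONLY (no definition, no instance, no notation, no named fact,
no `sorry`); kernel lane `--supports stmt-HodgeConjecture-24833`.  Cell `pub/hodgecm-mathlib` (D-0151), crux H413; road «S3-ram» (Literature seeding, count-neutral);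
J-PACK v2-iso (junction pen F0P3a-p01 (g17), skeleton v4) socket **S3 `row_offRegionSlice`**, binder order verbatim.  The region is `R = {v fixed, self-dual : LEV[v](ϖ^d₀)}`;
at a region vertex `v = u·r₀` every child passes (`d₀ ≥ 2`), and the count is ★ J6-mult (`v ≠ r₀`) ∕ ★ ROW-ROOT-SLICE (`v = r₀`) for the predicate `Q w := ¬LEV[w](ϖ^d₀) ∧ P w` —
once `Q` is SLICE-CONSTANT.  `P` is by hypothesis; for the region token this file proves (§1–§2) the dictionary entry
  **`LEV(ϖ^d)` at the far vertex `latt((uκ)·g(a,b))` ⟺ `|M₁₀|, |M₂₁| ≤ |ϖ|^{d+1} ∧ |M₂₀| ≤ |ϖ|^{d+2}`**, `M = (uκ)⁻¹(γ−1)(uκ)` of level `ϖ^d`, PROVIDED `|M₂₂ − M₀₀| ≤ |ϖ|^{d+1}`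
(★ F `v_childFrame_conj_sub_lower_le`: `g⁻¹Mg` differs from the level-`ϖ^d` part by the lower triangle `(a∕ϖ)M₁₀`, `ϖ⁻¹M₂₁`, `(a∕ϖ²)M₂₀ + (b∕ϖ)(M₂₂ − M₀₀)` — the only
`b`-dependence dies under the diagonal congruence) — a condition on the LINE `κe₀` only, not on the lift `b`.  The diagonal congruence is the residual `J₀`-symmetry of `Ȳ` at ODD
depth (★ K `v_coe_sub_one_apply_sub_rev_le_of_odd` at `(2,2)`), and `d₀` IS odd (§3): a norm-one unit `≡ 1 (ϖ^d)` with `d` even is `≡ 1 (ϖ^{d+1})` (`σϖ = −ϖ`, `σ ≡ id` residually,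
`|2| = 1`), which the exact isoceles gap `|s_{i₀} − s_j| = |ϖ|^{d₀}` forbids.

HONEST LABEL: HC_CM is proved only modulo the 2 remaining named inputs (hLiu418 24832, h413 24833) until rung 0 closes; nothing printed is asserted here (valuation algebra and
rooted-tree bookkeeping over ★ results); «S3-ram» has no books consequence.

## References
* [Kottwitz1986] R. E. Kottwitz, *Base change for unit elements of Hecke algebras*, Compositio Math. 60 (1986), §3 (levels of fixed lattices; counting shell by shell).
* [BruhatTits1972] F. Bruhat, J. Tits, *Groupes réductifs sur un corps local I*, Publ. Math. IHÉS 41 (1972), §10 (lattice models; vertex stabilisers, congruence filtration).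
* [Tits1979] J. Tits, *Reductive groups over local fields*, PSPM 33.1 (1979), §3.5 (reduction mod `𝔭`).
* [Serre1980Trees] J.-P. Serre, *Trees* (1980), Ch. I §2.3, Ch. II §1.1 (rooted trees; neighbours of a lattice).
-/

set_option autoImplicit false

noncomputable section

open scoped Valued WithZero Matrix MatrixGroups

namespace Literature.NumberTheory.Automorphic.UnitaryLatticeTree

open Literature.NumberTheory.Automorphic Literature.NumberTheory.Automorphic.HermitianLattice
open Literature.NumberTheory.Automorphic.CartanUnique
open Literature.Combinatorics.SimpleGraph.TreeLayers

variable {K : Type*} [Field K] [Valued K ℤᵐ⁰] {σ : K →+* K} {ϖ : K}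

/-! ## §1 `LEV(ϖ^d)` at a far vertex is a condition on the line (matrix and token forms) -/

/-- **`LEV(ϖ^d)` AT THE NEIGHBOUR `latt(κ·g(a,b))`, matrix form**: for `M` of level `ϖ^d` (`d ≥ 1`) with the diagonal congruence `|M₂₂ − M₀₀| ≤ |ϖ|^{d+1}`, ALL entries of
`g⁻¹Mg` are `≤ |ϖ|^d` iff `|M₁₀|, |M₂₁| ≤ |ϖ|^{d+1}` and `|M₂₀| ≤ |ϖ|^{d+2}` — independent of `a, b` (★ F `v_childFrame_conj_sub_lower_le`). [cite: Kottwitz1986, §3]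
[cite: Tits1979, §3.5] -/
theorem forall_v_childFrame_conj_le_iff_of_diag (hϖ : Valued.v ϖ = WithZero.exp (-1 : ℤ)) {a b : K} (ha : Valued.v a = 1) (hb : Valued.v b ≤ 1)
    {d : ℕ} (hd : 1 ≤ d) {M : Matrix (Fin 3) (Fin 3) K} (hM : ∀ i j, Valued.v (M i j) ≤ Valued.v ϖ ^ d)
    (hdiag : Valued.v (M 2 2 - M 0 0) ≤ Valued.v ϖ ^ (d + 1)) :
    (∀ i j : Fin 3, Valued.v (((!![ϖ / a, 0, 0; 0, 1, 0; -b / a, 0, ϖ⁻¹] : Matrix (Fin 3) (Fin 3) K) * M * !![a / ϖ, 0, 0; 0, 1, 0; b, 0, ϖ]) i j) ≤ Valued.v ϖ ^ d) ↔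
      (Valued.v (M 1 0) ≤ Valued.v ϖ ^ (d + 1) ∧ Valued.v (M 2 1) ≤ Valued.v ϖ ^ (d + 1) ∧ Valued.v (M 2 0) ≤ Valued.v ϖ ^ (d + 2)) := by
  have hϖ0 : ϖ ≠ 0 := fun h0 => by rw [h0, map_zero] at hϖ; exact WithZero.coe_ne_zero hϖ.symm
  have hvϖ0 : Valued.v ϖ ≠ 0 := (Valuation.ne_zero_iff _).2 hϖ0
  -- the `b`-term of the corner is small under the diagonal congruence
  have htail : Valued.v (b / ϖ * (M 2 2 - M 0 0)) ≤ Valued.v ϖ ^ d := by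
    rw [map_mul, map_div₀]
    calc Valued.v b / Valued.v ϖ * Valued.v (M 2 2 - M 0 0) ≤ 1 / Valued.v ϖ * Valued.v ϖ ^ (d + 1) :=
          mul_le_mul' (div_le_div_of_nonneg_right hb zero_le) hdiag
      _ = Valued.v ϖ ^ d := by rw [one_div, pow_succ', ← mul_assoc, inv_mul_cancel₀ hvϖ0, one_mul]
  constructor
  · intro hM'
    obtain ⟨h10, h21, -⟩ := v_apply_le_succ_of_forall_v_childFrame_conj_le hϖ ha hb hd hM hM'
    refine ⟨h10, h21, ?_⟩
    have hsub := v_childFrame_conj_sub_lower_le hϖ ha hb hM 2 0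
    rw [Matrix.sub_apply] at hsub
    have hL : Valued.v (a / ϖ ^ 2 * M 2 0 + b / ϖ * (M 2 2 - M 0 0)) ≤ Valued.v ϖ ^ d := by
      have e : a / ϖ ^ 2 * M 2 0 + b / ϖ * (M 2 2 - M 0 0) =
          ((!![ϖ / a, 0, 0; 0, 1, 0; -b / a, 0, ϖ⁻¹] : Matrix (Fin 3) (Fin 3) K) * M * !![a / ϖ, 0, 0; 0, 1, 0; b, 0, ϖ]) 2 0 - (((!![ϖ / a, 0, 0; 0, 1, 0; -b / a, 0, ϖ⁻¹] : Matrix (Fin 3) (Fin 3) K) * M * !![a / ϖ, 0, 0; 0, 1, 0; b, 0, ϖ]) 2 0 - (!![0, 0, 0; (a / ϖ) * M 1 0, 0, 0; (a / ϖ ^ 2) * M 2 0 + (b / ϖ) * (M 2 2 - M 0 0), ϖ⁻¹ * M 2 1, 0] : Matrix (Fin 3) (Fin 3) K) 2 0) := by simp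
      rw [e]; exact (Valuation.map_sub _ _ _).trans (max_le (hM' 2 0) hsub)
    have hc : Valued.v (a / ϖ ^ 2 * M 2 0) ≤ Valued.v ϖ ^ d := by
      have e : a / ϖ ^ 2 * M 2 0 = (a / ϖ ^ 2 * M 2 0 + b / ϖ * (M 2 2 - M 0 0)) - b / ϖ * (M 2 2 - M 0 0) := by ring
      rw [e]; exact (Valuation.map_sub _ _ _).trans (max_le hL htail)
    rw [map_mul, map_div₀, map_pow, ha, one_div] at hc
    have h' := mul_le_mul' (le_refl (Valued.v ϖ ^ 2)) hc
    rwa [← mul_assoc, mul_inv_cancel₀ (pow_ne_zero _ hvϖ0), one_mul, ← pow_add, add_comm] at h'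
  · rintro ⟨h10, h21, h20⟩ i j
    have h10' : Valued.v (a / ϖ * M 1 0) ≤ Valued.v ϖ ^ d := by
      rw [map_mul, map_div₀, ha, one_div]
      calc (Valued.v ϖ)⁻¹ * Valued.v (M 1 0) ≤ (Valued.v ϖ)⁻¹ * Valued.v ϖ ^ (d + 1) := mul_le_mul' le_rfl h10
        _ = Valued.v ϖ ^ d := by rw [pow_succ', ← mul_assoc, inv_mul_cancel₀ hvϖ0, one_mul]
    have h21' : Valued.v (ϖ⁻¹ * M 2 1) ≤ Valued.v ϖ ^ d := by
      rw [map_mul, map_inv₀]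
      calc (Valued.v ϖ)⁻¹ * Valued.v (M 2 1) ≤ (Valued.v ϖ)⁻¹ * Valued.v ϖ ^ (d + 1) := mul_le_mul' le_rfl h21
        _ = Valued.v ϖ ^ d := by rw [pow_succ', ← mul_assoc, inv_mul_cancel₀ hvϖ0, one_mul]
    have h20' : Valued.v (a / ϖ ^ 2 * M 2 0 + b / ϖ * (M 2 2 - M 0 0)) ≤ Valued.v ϖ ^ d := by
      refine (Valuation.map_add _ _ _).trans (max_le ?_ htail)
      rw [map_mul, map_div₀, map_pow, ha, one_div]
      calc (Valued.v ϖ ^ 2)⁻¹ * Valued.v (M 2 0) ≤ (Valued.v ϖ ^ 2)⁻¹ * Valued.v ϖ ^ (d + 2) := mul_le_mul' le_rfl h20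
        _ = Valued.v ϖ ^ d := by rw [pow_add, mul_comm (Valued.v ϖ ^ d), ← mul_assoc, inv_mul_cancel₀ (pow_ne_zero _ hvϖ0), one_mul]
    have hsub := v_childFrame_conj_sub_lower_le hϖ ha hb hM i j
    rw [Matrix.sub_apply] at hsub
    have hLij : Valued.v ((!![0, 0, 0; (a / ϖ) * M 1 0, 0, 0; (a / ϖ ^ 2) * M 2 0 + (b / ϖ) * (M 2 2 - M 0 0), ϖ⁻¹ * M 2 1, 0] : Matrix (Fin 3) (Fin 3) K) i j) ≤ Valued.v ϖ ^ d := by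
      fin_cases i <;> fin_cases j <;> first | (simp; done) | (simpa using h10') | (simpa using h21') | (simpa using h20')
    calc Valued.v (((!![ϖ / a, 0, 0; 0, 1, 0; -b / a, 0, ϖ⁻¹] : Matrix (Fin 3) (Fin 3) K) * M * !![a / ϖ, 0, 0; 0, 1, 0; b, 0, ϖ]) i j) = Valued.v ((((!![ϖ / a, 0, 0; 0, 1, 0; -b / a, 0, ϖ⁻¹] : Matrix (Fin 3) (Fin 3) K) * M * !![a / ϖ, 0, 0; 0, 1, 0; b, 0, ϖ]) i j - (!![0, 0, 0; (a / ϖ) * M 1 0, 0, 0; (a / ϖ ^ 2) * M 2 0 + (b / ϖ) * (M 2 2 - M 0 0), ϖ⁻¹ * M 2 1, 0] : Matrix (Fin 3) (Fin 3) K) i j) + (!![0, 0, 0; (a / ϖ) * M 1 0, 0, 0; (a / ϖ ^ 2) * M 2 0 + (b / ϖ) * (M 2 2 - M 0 0), ϖ⁻¹ * M 2 1, 0] : Matrix (Fin 3) (Fin 3) K) i j) := by rw [sub_add_cancel]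
      _ ≤ max (Valued.v (((!![ϖ / a, 0, 0; 0, 1, 0; -b / a, 0, ϖ⁻¹] : Matrix (Fin 3) (Fin 3) K) * M * !![a / ϖ, 0, 0; 0, 1, 0; b, 0, ϖ]) i j - (!![0, 0, 0; (a / ϖ) * M 1 0, 0, 0; (a / ϖ ^ 2) * M 2 0 + (b / ϖ) * (M 2 2 - M 0 0), ϖ⁻¹ * M 2 1, 0] : Matrix (Fin 3) (Fin 3) K) i j)) (Valued.v ((!![0, 0, 0; (a / ϖ) * M 1 0, 0, 0; (a / ϖ ^ 2) * M 2 0 + (b / ϖ) * (M 2 2 - M 0 0), ϖ⁻¹ * M 2 1, 0] : Matrix (Fin 3) (Fin 3) K) i j)) := Valuation.map_add _ _ _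
      _ ≤ Valued.v ϖ ^ d := max_le hsub hLij

/-- **`LEV(ϖ^d)` AT THE NEIGHBOUR `latt(κ·g(a,b))`, token form**: `(γ−1)·Λ′ ⊆ ϖ^d·Λ′ ⟺ |M₁₀|, |M₂₁| ≤ |ϖ|^{d+1} ∧ |M₂₀| ≤ |ϖ|^{d+2}`, `M = κ⁻¹(γ−1)κ` of level `ϖ^d` with
`|M₂₂ − M₀₀| ≤ |ϖ|^{d+1}` — the same for every lift `b` and every unit `a`: region membership is read on the LINE. [cite: Kottwitz1986, §3] [cite: Tits1979, §3.5] -/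
theorem map_sub_one_childLatt_le_scaleLattice_iff_of_diag (hϖ : Valued.v ϖ = WithZero.exp (-1 : ℤ)) (κ γ : GL (Fin 3) K) {a b : K} (ha : Valued.v a = 1) (hb : Valued.v b ≤ 1)
    {d : ℕ} (hd : 1 ≤ d) (hM : ∀ i j, Valued.v (((((κ⁻¹ : GL (Fin 3) K)) : Matrix (Fin 3) (Fin 3) K) * ((γ : Matrix (Fin 3) (Fin 3) K) - 1) * (κ : Matrix (Fin 3) (Fin 3) K)) i j) ≤ Valued.v ϖ ^ d)
    (hdiag : Valued.v (((((κ⁻¹ : GL (Fin 3) K)) : Matrix (Fin 3) (Fin 3) K) * ((γ : Matrix (Fin 3) (Fin 3) K) - 1) * (κ : Matrix (Fin 3) (Fin 3) K)) 2 2 - ((((κ⁻¹ : GL (Fin 3) K)) : Matrix (Fin 3) (Fin 3) K) * ((γ : Matrix (Fin 3) (Fin 3) K) - 1) * (κ : Matrix (Fin 3) (Fin 3) K)) 0 0) ≤ Valued.v ϖ ^ (d + 1)) :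
    (latt ((κ : Matrix (Fin 3) (Fin 3) K) * !![a / ϖ, 0, 0; 0, 1, 0; b, 0, ϖ])).map ((Matrix.toLin' ((γ : Matrix (Fin 3) (Fin 3) K) - 1)).restrictScalars 𝒪[K]) ≤ scaleLattice (ϖ ^ d) (latt ((κ : Matrix (Fin 3) (Fin 3) K) * !![a / ϖ, 0, 0; 0, 1, 0; b, 0, ϖ])) ↔
      (Valued.v (((((κ⁻¹ : GL (Fin 3) K)) : Matrix (Fin 3) (Fin 3) K) * ((γ : Matrix (Fin 3) (Fin 3) K) - 1) * (κ : Matrix (Fin 3) (Fin 3) K)) 1 0) ≤ Valued.v ϖ ^ (d + 1) ∧ Valued.v (((((κ⁻¹ : GL (Fin 3) K)) : Matrix (Fin 3) (Fin 3) K) * ((γ : Matrix (Fin 3) (Fin 3) K) - 1) * (κ : Matrix (Fin 3) (Fin 3) K)) 2 1) ≤ Valued.v ϖ ^ (d + 1) ∧ Valued.v (((((κ⁻¹ : GL (Fin 3) K)) : Matrix (Fin 3) (Fin 3) K) * ((γ : Matrix (Fin 3) (Fin 3) K) - 1) * (κ : Matrix (Fin 3) (Fin 3) K)) 2 0) ≤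 Valued.v ϖ ^ (d + 2)) := by
  have hϖ0 : ϖ ≠ 0 := fun h0 => by rw [h0, map_zero] at hϖ; exact WithZero.coe_ne_zero hϖ.symm
  have ha0 : a ≠ 0 := fun h0 => by rw [h0, map_zero] at ha; exact zero_ne_one ha
  rw [map_toLin'_latt_le_scaleLattice_iff (pow_ne_zero _ hϖ0) _ (isUnit_det_coe_mul_childFrame κ hϖ0 ha0 b), inv_coe_mul_childFrame_conj_eq κ hϖ0 ha0, map_pow]
  exact forall_v_childFrame_conj_le_iff_of_diag hϖ ha hb hd hM hdiag

/-! ## §2 Coordinates of a far vertex in a given frame, and the constancy of `LEV(ϖ^d)` along a slice -/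

/-- **Coordinates in a GIVEN frame**: if `κ ∈ K₀` frames the child `c = (uκ)·N₁` of `u·r₀`, every neighbour `w ≠ u·r₀` of `c` is `latt((uκ)·g(a,b))` with `|a| = 1`, `|b| ≤ 1`
(★ L `exists_frame_of_mem_neighborSet_neighborSet` with the frame prescribed). [cite: BruhatTits1972, §10] [cite: Serre1980Trees, II.1.1] -/
theorem exists_coords_of_adj_latticeGraphIso_N₁ (hvσ : ∀ a, Valued.v (σ a) = Valued.v a) (hσϖ : σ ϖ = -ϖ)
    (hϖ : Valued.v ϖ = WithZero.exp (-1 : ℤ)) (hres : ∀ x : K, Valued.v x ≤ 1 → Valued.v (σ x - x) < 1)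
    (u : unitaryGroupOfForm σ ((StdForm.antidiagonal 3).over K)) {κ : unitaryGroupOfForm σ ((StdForm.antidiagonal 3).over K)} (hκ : κ ∈ unitaryInt σ ((StdForm.antidiagonal 3).over K))
    {w : {M : Submodule 𝒪[K] (Fin 3 → K) // IsVertex σ ϖ ((StdForm.antidiagonal 3).over K) M}} (hcw : (latticeGraph σ ϖ ((StdForm.antidiagonal 3).over K)).Adj (latticeGraphIso σ ϖ ((StdForm.antidiagonal 3).over K) (u * κ) ⟨latt (Matrix.diagonal ![(1 : K), 1, ϖ]), 2, isVertexLattice_two_N₁_of_neg hσϖ hϖ⟩) w) (hne : w ≠ latticeGraphIso σ ϖ ((StdForm.antidiagonal 3).over K) u ⟨stdLattice K 3, 0, isSelfDualLattice_stdLattice_three_of_v hϖ⟩) :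
    ∃ a b : K, Valued.v a = 1 ∧ Valued.v b ≤ 1 ∧
      w.1 = latt ((((u * κ : unitaryGroupOfForm σ ((StdForm.antidiagonal 3).over K)) : GL (Fin 3) K) : Matrix (Fin 3) (Fin 3) K) * !![a / ϖ, 0, 0; 0, 1, 0; b, 0, ϖ]) := by
  set w' := latticeGraphIso σ ϖ ((StdForm.antidiagonal 3).over K) (u * κ)⁻¹ w with hw'def
  have hww' : latticeGraphIso σ ϖ ((StdForm.antidiagonal 3).over K) (u * κ) w' = w := latticeGraphIso_mul_inv_apply _ _
  have hw' : w' ∈ (latticeGraph σ ϖ ((StdForm.antidiagonal 3).over K)).neighborSet ⟨latt (Matrix.diagonal ![(1 : K), 1, ϖ]), 2, isVertexLattice_two_N₁_of_neg hσϖ hϖ⟩ := by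
    rw [SimpleGraph.mem_neighborSet, ← (latticeGraphIso σ ϖ ((StdForm.antidiagonal 3).over K) (u * κ)).map_adj_iff, hww']
    exact hcw
  have hne' : w'.1 ≠ stdLattice K 3 := by
    intro h
    apply hne
    have hroot : w' = ⟨stdLattice K 3, 0, isSelfDualLattice_stdLattice_three_of_v hϖ⟩ := Subtype.ext h
    rw [← hww', hroot, latticeGraphIso_mul_apply, latticeGraphIso_root_eq_of_mem_unitaryInt hϖ hκ]
  obtain ⟨a, b, ha, hb, hw'1⟩ := exists_unit_vec_of_mem_neighborSet_N₁_of_ne_stdLattice hvσ hσϖ hϖ hres hw' hne'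
  refine ⟨a, b, ha, hb, ?_⟩
  rw [← hww', latticeGraphIso_apply_val, hw'1, latt_coe_mul_childFrame_eq hϖ _ ha hb]

/-- **`LEV(ϖ^d)` IS CONSTANT ALONG A SLICE**: at `v = u·r₀`, for the child `(uκ)·N₁` (`κ ∈ K₀`) with `Y = (uκ)⁻¹γ(uκ) − 1` of level `ϖ^d` (`d ≥ 1`) and `|Y₂₂ − Y₀₀| ≤ |ϖ|^{d+1}`,
every far vertex `w ≠ v` through it has `LEV[w](ϖ^d) ⟺ |Y₁₀|, |Y₂₁| ≤ |ϖ|^{d+1} ∧ |Y₂₀| ≤ |ϖ|^{d+2}` — the same for all `q` of them. [cite: Kottwitz1986, §3] [cite: Tits1979, §3.5]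
[cite: BruhatTits1972, §10] -/
theorem map_sub_one_le_scaleLattice_iff_of_adj_latticeGraphIso_N₁ (hvσ : ∀ a, Valued.v (σ a) = Valued.v a) (hσϖ : σ ϖ = -ϖ)
    (hϖ : Valued.v ϖ = WithZero.exp (-1 : ℤ)) (hres : ∀ x : K, Valued.v x ≤ 1 → Valued.v (σ x - x) < 1)
    (u : unitaryGroupOfForm σ ((StdForm.antidiagonal 3).over K)) {κ : unitaryGroupOfForm σ ((StdForm.antidiagonal 3).over K)} (hκ : κ ∈ unitaryInt σ ((StdForm.antidiagonal 3).over K)) (γ : unitaryGroupOfForm σ ((StdForm.antidiagonal 3).over K)) {d : ℕ} (hd : 1 ≤ d)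
    (hY : ∀ i j, Valued.v ((((((u * κ)⁻¹ * γ * (u * κ) : unitaryGroupOfForm σ ((StdForm.antidiagonal 3).over K)) : GL (Fin 3) K) : Matrix (Fin 3) (Fin 3) K) - 1) i j) ≤ Valued.v ϖ ^ d)
    (hdiag : Valued.v ((((((u * κ)⁻¹ * γ * (u * κ) : unitaryGroupOfForm σ ((StdForm.antidiagonal 3).over K)) : GL (Fin 3) K) : Matrix (Fin 3) (Fin 3) K) - 1) 2 2 - (((((u * κ)⁻¹ * γ * (u * κ) : unitaryGroupOfForm σ ((StdForm.antidiagonal 3).over K)) : GL (Fin 3) K) : Matrix (Fin 3) (Fin 3) K) - 1) 0 0) ≤ Valued.v ϖ ^ (d + 1))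
    {w : {M : Submodule 𝒪[K] (Fin 3 → K) // IsVertex σ ϖ ((StdForm.antidiagonal 3).over K) M}} (hcw : (latticeGraph σ ϖ ((StdForm.antidiagonal 3).over K)).Adj (latticeGraphIso σ ϖ ((StdForm.antidiagonal 3).over K) (u * κ) ⟨latt (Matrix.diagonal ![(1 : K), 1, ϖ]), 2, isVertexLattice_two_N₁_of_neg hσϖ hϖ⟩) w) (hne : w ≠ latticeGraphIso σ ϖ ((StdForm.antidiagonal 3).over K) u ⟨stdLattice K 3, 0, isSelfDualLattice_stdLattice_three_of_v hϖ⟩) :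
    w.1.map ((Matrix.toLin' (((γ : GL (Fin 3) K) : Matrix (Fin 3) (Fin 3) K) - 1)).restrictScalars 𝒪[K]) ≤ scaleLattice (ϖ ^ d) w.1 ↔
      (Valued.v ((((((u * κ)⁻¹ * γ * (u * κ) : unitaryGroupOfForm σ ((StdForm.antidiagonal 3).over K)) : GL (Fin 3) K) : Matrix (Fin 3) (Fin 3) K) - 1) 1 0) ≤ Valued.v ϖ ^ (d + 1) ∧ Valued.v ((((((u * κ)⁻¹ * γ * (u * κ) : unitaryGroupOfForm σ ((StdForm.antidiagonal 3).over K)) : GL (Fin 3) K) : Matrix (Fin 3) (Fin 3) K) - 1) 2 1) ≤ Valued.v ϖ ^ (d + 1) ∧ Valued.v ((((((u * κ)⁻¹ * γ * (u * κ) : unitaryGroupOfForm σ ((StdForm.antidiagonal 3).over K)) : GL (Fin 3) K) : Matrix (Fin 3) (Fin 3) K) - 1) 2 0) ≤ Valued.v ϖ ^ (d + 2)) := by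
  obtain ⟨a, b, ha, hb, hw1⟩ := exists_coords_of_adj_latticeGraphIso_N₁ hvσ hσϖ hϖ hres u hκ hcw hne
  have hM : (((((u * κ)⁻¹ * γ * (u * κ) : unitaryGroupOfForm σ ((StdForm.antidiagonal 3).over K)) : GL (Fin 3) K) : Matrix (Fin 3) (Fin 3) K) - 1) = (((((u * κ : unitaryGroupOfForm σ ((StdForm.antidiagonal 3).over K)) : GL (Fin 3) K)⁻¹ : GL (Fin 3) K) : Matrix (Fin 3) (Fin 3) K) * (((γ : GL (Fin 3) K) : Matrix (Fin 3) (Fin 3) K) - 1) * (((u * κ : unitaryGroupOfForm σ ((StdForm.antidiagonal 3).over K)) : GL (Fin 3) K) : Matrix (Fin 3) (Fin 3) K)) := coe_inv_mul_mul_sub_one γ (u * κ)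
  have hY' : ∀ i j, Valued.v ((((((u * κ : unitaryGroupOfForm σ ((StdForm.antidiagonal 3).over K)) : GL (Fin 3) K)⁻¹ : GL (Fin 3) K) : Matrix (Fin 3) (Fin 3) K) * (((γ : GL (Fin 3) K) : Matrix (Fin 3) (Fin 3) K) - 1) * (((u * κ : unitaryGroupOfForm σ ((StdForm.antidiagonal 3).over K)) : GL (Fin 3) K) : Matrix (Fin 3) (Fin 3) K)) i j) ≤ Valued.v ϖ ^ d := fun i j => by rw [← hM]; exact hY i j
  have hdiag' : Valued.v ((((((u * κ : unitaryGroupOfForm σ ((StdForm.antidiagonal 3).over K)) : GL (Fin 3) K)⁻¹ : GL (Fin 3) K) : Matrix (Fin 3) (Fin 3) K) * (((γ : GL (Fin 3) K) : Matrix (Fin 3) (Fin 3) K) - 1) * (((u * κ : unitaryGroupOfForm σ ((StdForm.antidiagonal 3).over K)) : GL (Fin 3) K) : Matrix (Fin 3) (Fin 3) K)) 2 2 - (((((u * κ : unitaryGroupOfForm σ ((StdForm.antidiagonal 3).over K)) : GL (Fin 3) K)⁻¹ : GL (Fin 3) K) : Matrix (Fin 3) (Fin 3) K) * (((γ : GL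 (Fin 3) K) : Matrix (Fin 3) (Fin 3) K) - 1) * (((u * κ : unitaryGroupOfForm σ ((StdForm.antidiagonal 3).over K)) : GL (Fin 3) K) : Matrix (Fin 3) (Fin 3) K)) 0 0) ≤ Valued.v ϖ ^ (d + 1) := by rw [← hM]; exact hdiag
  rw [hw1, map_sub_one_childLatt_le_scaleLattice_iff_of_diag hϖ ((u * κ : unitaryGroupOfForm σ ((StdForm.antidiagonal 3).over K)) : GL (Fin 3) K) (γ : GL (Fin 3) K) ha hb hd hY' hdiag', hM]

/-! ## §3 The isoceles eigen-data force ODD depth -/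

/-- **A NORM-ONE UNIT `≡ 1 (ϖ^d)` WITH `d` EVEN (`d ≠ 0`) IS `≡ 1 (ϖ^{d+1})`**: with `s = 1 + ϖ^d y`, `sσ(s) = 1` and `σ(ϖ^d) = ϖ^d` give `y + σy = −ϖ^d yσy`, so
`|2y| ≤ max(|y + σy|, |σy − y|) < 1` (`σ ≡ id` residually), i.e. `|y| < 1`. [cite: Tits1979, §3.5] [cite: BruhatTits1972, §10] -/
theorem v_sub_one_le_pow_succ_of_mul_sigma_eq_one_of_even (hvσ : ∀ a, Valued.v (σ a) = Valued.v a) (hσϖ : σ ϖ = -ϖ)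
    (hϖ : Valued.v ϖ = WithZero.exp (-1 : ℤ)) (hres : ∀ x : K, Valued.v x ≤ 1 → Valued.v (σ x - x) < 1) (h2 : Valued.v (2 : K) = 1)
    {s : K} (hsσ : s * σ s = 1) {d : ℕ} (hd : Even d) (hd0 : d ≠ 0) (hs : Valued.v (s - 1) ≤ Valued.v ϖ ^ d) :
    Valued.v (s - 1) ≤ Valued.v ϖ ^ (d + 1) := by
  have hϖ0 : ϖ ≠ 0 := fun h0 => by rw [h0, map_zero] at hϖ; exact WithZero.coe_ne_zero hϖ.symm
  have hvϖ0 : Valued.v ϖ ≠ 0 := (Valuation.ne_zero_iff _).2 hϖ0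
  have hϖ1 : Valued.v ϖ < 1 := by rw [hϖ, ← WithZero.exp_zero]; exact WithZero.exp_lt_exp.2 (by norm_num)
  have hlt1 : ∀ z : K, Valued.v z < 1 ↔ Valued.v z ≤ Valued.v ϖ := fun z => by rw [hϖ]; exact v_lt_one_iff z
  set y : K := (ϖ ^ d)⁻¹ * (s - 1) with hydef
  have hx : s - 1 = ϖ ^ d * y := by rw [hydef, ← mul_assoc, mul_inv_cancel₀ (pow_ne_zero _ hϖ0), one_mul]
  have hyv : Valued.v y ≤ 1 := by
    rw [hydef, map_mul, map_inv₀, map_pow]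
    calc (Valued.v ϖ ^ d)⁻¹ * Valued.v (s - 1) ≤ (Valued.v ϖ ^ d)⁻¹ * Valued.v ϖ ^ d := mul_le_mul' le_rfl hs
      _ = 1 := inv_mul_cancel₀ (pow_ne_zero _ hvϖ0)
  have hσϖd : σ (ϖ ^ d) = ϖ ^ d := by rw [map_pow, hσϖ, Even.neg_pow hd]
  -- `y + σ y = -(ϖ^d · y · σ y)`
  have hid : (s - 1) + σ (s - 1) = -((s - 1) * σ (s - 1)) := by
    rw [map_sub, map_one]; linear_combination hsσ
  have hid' : y + σ y = -(ϖ ^ d * (y * σ y)) := by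
    rw [hx, map_mul, hσϖd] at hid
    apply mul_left_cancel₀ (pow_ne_zero d hϖ0)
    linear_combination hid
  have hsum : Valued.v (y + σ y) < 1 := by
    rw [hid', Valuation.map_neg, map_mul, map_mul, map_pow, hvσ]
    calc Valued.v ϖ ^ d * (Valued.v y * Valued.v y) ≤ Valued.v ϖ ^ d * (1 * 1) := mul_le_mul' le_rfl (mul_le_mul' hyv hyv)
      _ = Valued.v ϖ ^ d := by rw [mul_one, mul_one]
      _ < 1 := pow_lt_one₀ zero_le hϖ1 hd0
  have h2y : Valued.v (2 * y) < 1 := by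
    have e : 2 * y = (y + σ y) - (σ y - y) := by ring
    rw [e]
    exact lt_of_le_of_lt (Valuation.map_sub _ _ _) (max_lt hsum (hres y hyv))
  rw [map_mul, h2, one_mul, hlt1] at h2y
  rw [hx, map_mul, map_pow, pow_succ]
  exact mul_le_mul' le_rfl h2y

/-- **THE ISOCELES EIGEN-DATA FORCE ODD DEPTH**: norm-one eigenvalues `s_i ≡ 1 (ϖ^{d₀})` with an EXACT gap `|s_{i₀} − s_j| = |ϖ|^{d₀}` (`j ≠ i₀`) cannot have `d₀` even
(else all `s_i ≡ 1 (ϖ^{d₀+1})`). [cite: Tits1979, §3.5] [cite: BruhatTits1972, §10] -/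
theorem odd_of_isoceles_eigenvalues (hvσ : ∀ a, Valued.v (σ a) = Valued.v a) (hσϖ : σ ϖ = -ϖ)
    (hϖ : Valued.v ϖ = WithZero.exp (-1 : ℤ)) (hres : ∀ x : K, Valued.v x ≤ 1 → Valued.v (σ x - x) < 1) (h2 : Valued.v (2 : K) = 1)
    (s : Fin 3 → K) (hsσ : ∀ i, s i * σ (s i) = 1) (i₀ : Fin 3) {d₀ : ℕ} (hd0 : d₀ ≠ 0) (he : ∀ i, Valued.v (s i - 1) ≤ Valued.v ϖ ^ d₀)
    (hiso : ∀ j, j ≠ i₀ → Valued.v (s i₀ - s j) = Valued.v ϖ ^ d₀) : Odd d₀ := by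
  have hϖ0 : ϖ ≠ 0 := fun h0 => by rw [h0, map_zero] at hϖ; exact WithZero.coe_ne_zero hϖ.symm
  have hvϖ0 : Valued.v ϖ ≠ 0 := (Valuation.ne_zero_iff _).2 hϖ0
  have hϖ1 : Valued.v ϖ < 1 := by rw [hϖ, ← WithZero.exp_zero]; exact WithZero.exp_lt_exp.2 (by norm_num)
  by_contra hodd
  have hev : Even d₀ := Nat.not_odd_iff_even.1 hodd
  obtain ⟨j, hj⟩ := exists_ne i₀
  have h0 := v_sub_one_le_pow_succ_of_mul_sigma_eq_one_of_even hvσ hσϖ hϖ hres h2 (hsσ i₀) hev hd0 (he i₀)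
  have h1 := v_sub_one_le_pow_succ_of_mul_sigma_eq_one_of_even hvσ hσϖ hϖ hres h2 (hsσ j) hev hd0 (he j)
  have hle : Valued.v (s i₀ - s j) ≤ Valued.v ϖ ^ (d₀ + 1) := by
    have e : s i₀ - s j = (s i₀ - 1) - (s j - 1) := by ring
    rw [e]; exact (Valuation.map_sub _ _ _).trans (max_le h0 h1)
  rw [hiso j hj] at hle
  have hlt : Valued.v ϖ ^ (d₀ + 1) < Valued.v ϖ ^ d₀ := by
    rw [pow_succ]; exact mul_lt_of_lt_one_right (zero_lt_iff.2 (pow_ne_zero _ hvϖ0)) hϖ1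
  exact absurd hle (not_le.2 hlt)

/-! ## §4 The socket S3 -/

section Three

/-- **S3 «OFF-REGION SLICE COUNT AT A REGION VERTEX» (J-PACK v2-iso, socket `row_offRegionSlice`)**: at a fixed self-dual vertex `v` with `LEV[v](ϖ^{d₀})` (`d₀ ≥ 3`;
isoceles eigen-data `s`, forcing `d₀` odd) and a slice-constant `P`, `#{w ∈ GC(v) : ¬LEV[w](ϖ^{d₀}) ∧ P w} = q · #{children c of v : ∀ w beyond c, ¬LEV[w](ϖ^{d₀}) ∧ P w}` — every
child passes (`d₀ ≥ 2`), and `¬LEV[·](ϖ^{d₀})` is itself slice-constant (§2 with the odd-depth diagonal congruence ★ K). [cite: Kottwitz1986, §3] [cite: BruhatTits1972, §10]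
[cite: Tits1979, §3.5] [cite: Serre1980Trees, I.2.3] -/
theorem ncard_offRegionGrandchildren_sep_eq_mul_ncard (hσ : ∀ x, σ (σ x) = x) (hvσ : ∀ a, Valued.v (σ a) = Valued.v a) (hσϖ : σ ϖ = -ϖ)
    (hϖ : Valued.v ϖ = WithZero.exp (-1 : ℤ)) (hres : ∀ x : K, Valued.v x ≤ 1 → Valued.v (σ x - x) < 1) (h2 : Valued.v (2 : K) = 1) [Finite 𝓀[K]]
    (hT : (latticeGraph σ ϖ ((StdForm.antidiagonal 3).over K)).IsTree)
    {γ : unitaryGroupOfForm σ ((StdForm.antidiagonal 3).over K)} (hγ0 : γ ∈ unitaryInt σ ((StdForm.antidiagonal 3).over K))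
    (d : Fin 3 → K) (_hd : ∀ i, Valued.v (d i) = 1) (_hdσ : ∀ i, σ (d i) = d i)
    (A : GL (Fin 3) K) (_hA : IsIntMatrix (A : Matrix (Fin 3) (Fin 3) K)) (_hA' : IsIntMatrix ((A⁻¹ : GL (Fin 3) K) : Matrix (Fin 3) (Fin 3) K))
    (_hdA : Matrix.diagonal d = (-(Matrix.diagonal d).det) • formCongr σ A ((StdForm.antidiagonal 3).over K))
    (s : Fin 3 → K) (_hs1 : s 1 = 1) (_hsv : ∀ i, Valued.v (s i) = 1) (hsσ : ∀ i, s i * σ (s i) = 1)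
    (_hγA : ((γ : GL (Fin 3) K) : Matrix (Fin 3) (Fin 3) K) = (A : Matrix (Fin 3) (Fin 3) K) * Matrix.diagonal s * ((A⁻¹ : GL (Fin 3) K) : Matrix (Fin 3) (Fin 3) K))
    (i₀ : Fin 3) {d₀ : ℕ} (hd3 : 3 ≤ d₀) (he : ∀ i, Valued.v (s i - 1) ≤ Valued.v ϖ ^ d₀)
    (hiso : ∀ j, j ≠ i₀ → Valued.v (s i₀ - s j) = Valued.v ϖ ^ d₀) (_hclose : ∀ j k, j ≠ i₀ → k ≠ i₀ → Valued.v (s j - s k) ≤ Valued.v ϖ ^ (d₀ + 2))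
    {v : {M : Submodule 𝒪[K] (Fin 3 → K) // IsVertex σ ϖ ((StdForm.antidiagonal 3).over K) M}} (hv : IsSelfDualLattice σ ϖ ((StdForm.antidiagonal 3).over K) v.1) (hfix : latticeGraphIso σ ϖ ((StdForm.antidiagonal 3).over K) γ v = v) (hvR : v.1.map ((Matrix.toLin' (((γ : GL (Fin 3) K) : Matrix (Fin 3) (Fin 3) K) - 1)).restrictScalars 𝒪[K]) ≤ scaleLattice (ϖ ^ d₀) v.1)
    (P : {M : Submodule 𝒪[K] (Fin 3 → K) // IsVertex σ ϖ ((StdForm.antidiagonal 3).over K) M} → Prop)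
    (hP : ∀ c, (latticeGraph σ ϖ ((StdForm.antidiagonal 3).over K)).Adj v c → (latticeGraph σ ϖ ((StdForm.antidiagonal 3).over K)).dist ⟨stdLattice K 3, 0, isSelfDualLattice_stdLattice_three_of_v hϖ⟩ c = (latticeGraph σ ϖ ((StdForm.antidiagonal 3).over K)).dist ⟨stdLattice K 3, 0, isSelfDualLattice_stdLattice_three_of_v hϖ⟩ v + 1 →
      ∀ w w', (latticeGraph σ ϖ ((StdForm.antidiagonal 3).over K)).Adj c w → (latticeGraph σ ϖ ((StdForm.antidiagonal 3).over K)).dist ⟨stdLattice K 3, 0, isSelfDualLattice_stdLattice_three_of_v hϖ⟩ w = (latticeGraph σ ϖ ((StdForm.antidiagonal 3).over K)).dist ⟨stdLattice K 3, 0, isSelfDualLattice_stdLattice_three_of_v hϖ⟩ c + 1 → (latticeGraph σ ϖ ((StdForm.antidiagonal 3).over K)).Adj c w' → (latticeGraph σ ϖ ((StdForm.antidiagonal 3).over K)).dist ⟨stdLattice K 3, 0, isSelfDualLattice_stdLattice_three_of_v hϖ⟩ w' = (latticeGraph σ ϖ ((StdForm.antidiagonal 3).over K)).dist ⟨stdLattice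 K 3, 0, isSelfDualLattice_stdLattice_three_of_v hϖ⟩ c + 1 → (P w ↔ P w')) :
    ({w | w ∈ {w | ∃ c, ((latticeGraph σ ϖ ((StdForm.antidiagonal 3).over K)).Adj v c ∧ (latticeGraph σ ϖ ((StdForm.antidiagonal 3).over K)).dist ⟨stdLattice K 3, 0, isSelfDualLattice_stdLattice_three_of_v hϖ⟩ c = (latticeGraph σ ϖ ((StdForm.antidiagonal 3).over K)).dist ⟨stdLattice K 3, 0, isSelfDualLattice_stdLattice_three_of_v hϖ⟩ v + 1 ∧ latticeGraphIso σ ϖ ((StdForm.antidiagonal 3).over K) γ c = c) ∧ ((latticeGraph σ ϖ ((StdForm.antidiagonal 3).over K)).Adj c w ∧ (latticeGraph σ ϖ ((StdForm.antidiagonal 3).over K)).dist ⟨stdLattice K 3, 0, isSelfDualLattice_stdLattice_three_of_v hϖ⟩ w = (latticeGraph σ ϖ ((StdForm.antidiagonal 3).over K)).dist ⟨stdLattice K 3, 0, isSelfDualLattice_stdLattice_three_of_v hϖ⟩ c + 1 ∧ latticeGraphIso σ ϖ ((StdForm.antidiagonal 3).over K) γ w = w)} ∧ (¬ w.1.map ((Matrix.toLin'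 (((γ : GL (Fin 3) K) : Matrix (Fin 3) (Fin 3) K) - 1)).restrictScalars 𝒪[K]) ≤ scaleLattice (ϖ ^ d₀) w.1 ∧ P w)}).ncard =
      Nat.card 𝓀[K] * {c | (latticeGraph σ ϖ ((StdForm.antidiagonal 3).over K)).Adj v c ∧ (latticeGraph σ ϖ ((StdForm.antidiagonal 3).over K)).dist ⟨stdLattice K 3, 0, isSelfDualLattice_stdLattice_three_of_v hϖ⟩ c = (latticeGraph σ ϖ ((StdForm.antidiagonal 3).over K)).dist ⟨stdLattice K 3, 0, isSelfDualLattice_stdLattice_three_of_v hϖ⟩ v + 1 ∧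
        ∀ w, (latticeGraph σ ϖ ((StdForm.antidiagonal 3).over K)).Adj c w → (latticeGraph σ ϖ ((StdForm.antidiagonal 3).over K)).dist ⟨stdLattice K 3, 0, isSelfDualLattice_stdLattice_three_of_v hϖ⟩ w = (latticeGraph σ ϖ ((StdForm.antidiagonal 3).over K)).dist ⟨stdLattice K 3, 0, isSelfDualLattice_stdLattice_three_of_v hϖ⟩ c + 1 → ¬ w.1.map ((Matrix.toLin' (((γ : GL (Fin 3) K) : Matrix (Fin 3) (Fin 3) K) - 1)).restrictScalars 𝒪[K]) ≤ scaleLattice (ϖ ^ d₀) w.1 ∧ P w}.ncard := by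
  classical
  have hϖ0 : ϖ ≠ 0 := fun h0 => by rw [h0, map_zero] at hϖ; exact WithZero.coe_ne_zero hϖ.symm
  have hϖ1 : Valued.v ϖ < 1 := by rw [hϖ, ← WithZero.exp_zero]; exact WithZero.exp_lt_exp.2 (by norm_num)
  have hd1 : 1 ≤ d₀ := by omega
  have hodd : Odd d₀ := odd_of_isoceles_eigenvalues hvσ hσϖ hϖ hres h2 s hsσ i₀ (by omega) he hiso
  -- ### the frame of `v`
  obtain ⟨u, hu⟩ := exists_latticeGraphIso_root_eq_of_v_two hσ hvσ hϖ h2 v hv (isSelfDualLattice_stdLattice_three_of_v hϖ)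
  subst hu
  have hframe : ∀ κ : unitaryGroupOfForm σ ((StdForm.antidiagonal 3).over K), κ ∈ unitaryInt σ ((StdForm.antidiagonal 3).over K) → latticeGraphIso σ ϖ ((StdForm.antidiagonal 3).over K) (u * κ) ⟨stdLattice K 3, 0, isSelfDualLattice_stdLattice_three_of_v hϖ⟩ = latticeGraphIso σ ϖ ((StdForm.antidiagonal 3).over K) u ⟨stdLattice K 3, 0, isSelfDualLattice_stdLattice_three_of_v hϖ⟩ := fun κ hκ => by
    rw [latticeGraphIso_mul_apply, latticeGraphIso_root_eq_of_mem_unitaryInt hϖ hκ]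
  -- level `ϖ^d₀` and the odd-depth diagonal congruence in every `K₀`-translate of the frame
  have hYκ : ∀ κ : unitaryGroupOfForm σ ((StdForm.antidiagonal 3).over K), κ ∈ unitaryInt σ ((StdForm.antidiagonal 3).over K) → ∀ i j, Valued.v ((((((u * κ)⁻¹ * γ * (u * κ) : unitaryGroupOfForm σ ((StdForm.antidiagonal 3).over K)) : GL (Fin 3) K) : Matrix (Fin 3) (Fin 3) K) - 1) i j) ≤ Valued.v ϖ ^ d₀ := fun κ hκ => by
    have h := (map_pow_le_scaleLattice_latticeGraphIso_root_iff hϖ γ (u * κ) (pow_ne_zero d₀ hϖ0) 1).1 (by rw [pow_one, hframe κ hκ]; exact hvR)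
    simpa only [pow_one, map_pow] using h
  have hdiagκ : ∀ κ : unitaryGroupOfForm σ ((StdForm.antidiagonal 3).over K), κ ∈ unitaryInt σ ((StdForm.antidiagonal 3).over K) → Valued.v ((((((u * κ)⁻¹ * γ * (u * κ) : unitaryGroupOfForm σ ((StdForm.antidiagonal 3).over K)) : GL (Fin 3) K) : Matrix (Fin 3) (Fin 3) K) - 1) 2 2 - (((((u * κ)⁻¹ * γ * (u * κ) : unitaryGroupOfForm σ ((StdForm.antidiagonal 3).over K)) : GL (Fin 3) K) : Matrix (Fin 3) (Fin 3) K) - 1) 0 0) ≤ Valued.v ϖ ^ (d₀ + 1) := fun κ hκ => by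
    have h := v_coe_sub_one_apply_sub_rev_le_of_odd hvσ hσϖ hϖ hres ((u * κ)⁻¹ * γ * (u * κ)) hodd (hYκ κ hκ) 2 2
    have h22 : (2 : Fin 3).rev = 0 := by decide
    rwa [h22] at h
  -- ### `Q w := ¬LEV[w](ϖ^d₀) ∧ P w` is slice-constant
  have hQ : ∀ c, (latticeGraph σ ϖ ((StdForm.antidiagonal 3).over K)).Adj (latticeGraphIso σ ϖ ((StdForm.antidiagonal 3).over K) u ⟨stdLattice K 3, 0, isSelfDualLattice_stdLattice_three_of_v hϖ⟩) c → (latticeGraph σ ϖ ((StdForm.antidiagonal 3).over K)).dist ⟨stdLattice K 3, 0, isSelfDualLattice_stdLattice_three_of_v hϖ⟩ c = (latticeGraph σ ϖ ((StdForm.antidiagonal 3).over K)).dist ⟨stdLattice K 3, 0, isSelfDualLattice_stdLattice_three_of_v hϖ⟩ (latticeGraphIso σ ϖ ((StdForm.antidiagonal 3).over K) u ⟨stdLattice K 3, 0, isSelfDualLattice_stdLattice_three_of_v hϖ⟩) + 1 →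
      ∀ w w', (latticeGraph σ ϖ ((StdForm.antidiagonal 3).over K)).Adj c w → (latticeGraph σ ϖ ((StdForm.antidiagonal 3).over K)).dist ⟨stdLattice K 3, 0, isSelfDualLattice_stdLattice_three_of_v hϖ⟩ w = (latticeGraph σ ϖ ((StdForm.antidiagonal 3).over K)).dist ⟨stdLattice K 3, 0, isSelfDualLattice_stdLattice_three_of_v hϖ⟩ c + 1 → (latticeGraph σ ϖ ((StdForm.antidiagonal 3).over K)).Adj c w' → (latticeGraph σ ϖ ((StdForm.antidiagonal 3).over K)).dist ⟨stdLattice K 3, 0, isSelfDualLattice_stdLattice_three_of_v hϖ⟩ w' = (latticeGraph σ ϖ ((StdForm.antidiagonal 3).over K)).dist ⟨stdLattice K 3, 0, isSelfDualLattice_stdLattice_three_of_v hϖ⟩ c + 1 →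
        ((¬ w.1.map ((Matrix.toLin' (((γ : GL (Fin 3) K) : Matrix (Fin 3) (Fin 3) K) - 1)).restrictScalars 𝒪[K]) ≤ scaleLattice (ϖ ^ d₀) w.1 ∧ P w) ↔ (¬ w'.1.map ((Matrix.toLin' (((γ : GL (Fin 3) K) : Matrix (Fin 3) (Fin 3) K) - 1)).restrictScalars 𝒪[K]) ≤ scaleLattice (ϖ ^ d₀) w'.1 ∧ P w')) := by
    intro c hvc hdc w w' hcw hdw hcw' hdw'
    have hne : w ≠ latticeGraphIso σ ϖ ((StdForm.antidiagonal 3).over K) u ⟨stdLattice K 3, 0, isSelfDualLattice_stdLattice_three_of_v hϖ⟩ := by intro h; rw [h] at hdw; omega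
    have hne' : w' ≠ latticeGraphIso σ ϖ ((StdForm.antidiagonal 3).over K) u ⟨stdLattice K 3, 0, isSelfDualLattice_stdLattice_three_of_v hϖ⟩ := by intro h; rw [h] at hdw'; omega
    obtain ⟨κ, hκ, hcκ⟩ := (mem_neighborSet_latticeGraphIso_root_iff hσ hvσ hσϖ hϖ h2 u c).1 ((SimpleGraph.mem_neighborSet _ _ _).2 hvc)
    have hcwκ : (latticeGraph σ ϖ ((StdForm.antidiagonal 3).over K)).Adj (latticeGraphIso σ ϖ ((StdForm.antidiagonal 3).over K) (u * κ) ⟨latt (Matrix.diagonal ![(1 : K), 1, ϖ]), 2, isVertexLattice_two_N₁_of_neg hσϖ hϖ⟩) w := by rw [← hcκ]; exact hcw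
    have hcwκ' : (latticeGraph σ ϖ ((StdForm.antidiagonal 3).over K)).Adj (latticeGraphIso σ ϖ ((StdForm.antidiagonal 3).over K) (u * κ) ⟨latt (Matrix.diagonal ![(1 : K), 1, ϖ]), 2, isVertexLattice_two_N₁_of_neg hσϖ hϖ⟩) w' := by rw [← hcκ]; exact hcw'
    have h₁ := map_sub_one_le_scaleLattice_iff_of_adj_latticeGraphIso_N₁ hvσ hσϖ hϖ hres u hκ γ hd1 (hYκ κ hκ) (hdiagκ κ hκ) hcwκ hne
    have h₂ := map_sub_one_le_scaleLattice_iff_of_adj_latticeGraphIso_N₁ hvσ hσϖ hϖ hres u hκ γ hd1 (hYκ κ hκ) (hdiagκ κ hκ) hcwκ' hne'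
    exact and_congr (not_congr (h₁.trans h₂.symm)) (hP c hvc hdc w w' hcw hdw hcw' hdw')
  rcases eq_or_ne (latticeGraphIso σ ϖ ((StdForm.antidiagonal 3).over K) u ⟨stdLattice K 3, 0, isSelfDualLattice_stdLattice_three_of_v hϖ⟩) ⟨stdLattice K 3, 0, isSelfDualLattice_stdLattice_three_of_v hϖ⟩ with hvr | hvr
  · -- ### THE ROOT CASE `v = r₀`: ★ ROW-ROOT-SLICE
    have hdeep : ∀ i j, Valued.v ((((γ : GL (Fin 3) K) : Matrix (Fin 3) (Fin 3) K) - 1) i j) ≤ Valued.v ϖ ^ 2 := by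
      have e : mapGL ((1 : unitaryGroupOfForm σ ((StdForm.antidiagonal 3).over K)) : GL (Fin 3) K) (stdLattice K 3) = (⟨stdLattice K 3, 0, isSelfDualLattice_stdLattice_three_of_v hϖ⟩ : {M : Submodule 𝒪[K] (Fin 3 → K) // IsVertex σ ϖ ((StdForm.antidiagonal 3).over K) M}).1 := by rw [Subgroup.coe_one, mapGL_one]
      have hvR' := hvR
      rw [hvr] at hvR'
      have h := (forall_v_conj_sub_one_le_iff_map_sub_one_le_scaleLattice γ (1 : unitaryGroupOfForm σ ((StdForm.antidiagonal 3).over K)) (pow_ne_zero d₀ hϖ0)).1 (by rw [e]; exact hvR')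
      intro i j
      have hij := h i j
      simp only [inv_one, one_mul, mul_one, map_pow] at hij
      exact hij.trans (pow_le_pow_right_of_le_one' hϖ1.le (by omega))
    rw [hvr] at hQ hP ⊢
    have hQr : ∀ c, (latticeGraph σ ϖ ((StdForm.antidiagonal 3).over K)).Adj ⟨stdLattice K 3, 0, isSelfDualLattice_stdLattice_three_of_v hϖ⟩ c → ∀ w w', (latticeGraph σ ϖ ((StdForm.antidiagonal 3).over K)).Adj c w → (latticeGraph σ ϖ ((StdForm.antidiagonal 3).over K)).dist ⟨stdLattice K 3, 0, isSelfDualLattice_stdLattice_three_of_v hϖ⟩ w = 2 → (latticeGraph σ ϖ ((StdForm.antidiagonal 3).over K)).Adj c w' → (latticeGraph σ ϖ ((StdForm.antidiagonal 3).over K)).dist ⟨stdLattice K 3, 0, isSelfDualLattice_stdLattice_three_of_v hϖ⟩ w' = 2 →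
        ((¬ w.1.map ((Matrix.toLin' (((γ : GL (Fin 3) K) : Matrix (Fin 3) (Fin 3) K) - 1)).restrictScalars 𝒪[K]) ≤ scaleLattice (ϖ ^ d₀) w.1 ∧ P w) ↔ (¬ w'.1.map ((Matrix.toLin' (((γ : GL (Fin 3) K) : Matrix (Fin 3) (Fin 3) K) - 1)).restrictScalars 𝒪[K]) ≤ scaleLattice (ϖ ^ d₀) w'.1 ∧ P w')) := by
      intro c hc w w' hcw hdw hcw' hdw'
      have hdc : (latticeGraph σ ϖ ((StdForm.antidiagonal 3).over K)).dist ⟨stdLattice K 3, 0, isSelfDualLattice_stdLattice_three_of_v hϖ⟩ c = 1 := SimpleGraph.dist_eq_one_iff_adj.2 hc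
      exact hQ c hc (by rw [hdc, SimpleGraph.dist_self]) w w' hcw (by rw [hdw, hdc]) hcw' (by rw [hdw', hdc])
    have hmain := ncard_rootGrandchildren_sep_eq_mul_ncard_of_congr_sq hσ hvσ hσϖ hϖ hres h2 hT hγ0 hdeep (fun w => ¬ w.1.map ((Matrix.toLin' (((γ : GL (Fin 3) K) : Matrix (Fin 3) (Fin 3) K) - 1)).restrictScalars 𝒪[K]) ≤ scaleLattice (ϖ ^ d₀) w.1 ∧ P w) hQr
    refine Eq.trans ?_ (hmain.trans ?_)
    · rfl
    · congr 1
      congr 1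
      ext c
      simp only [Set.mem_setOf_eq]
      constructor
      · rintro ⟨hc, hall⟩
        have hdc : (latticeGraph σ ϖ ((StdForm.antidiagonal 3).over K)).dist ⟨stdLattice K 3, 0, isSelfDualLattice_stdLattice_three_of_v hϖ⟩ c = 1 := SimpleGraph.dist_eq_one_iff_adj.2 hc
        exact ⟨hc, by rw [hdc, SimpleGraph.dist_self], fun w hw hdw => hall w hw (by rw [hdw, hdc])⟩
      · rintro ⟨hc, -, hall⟩
        have hdc : (latticeGraph σ ϖ ((StdForm.antidiagonal 3).over K)).dist ⟨stdLattice K 3, 0, isSelfDualLattice_stdLattice_three_of_v hϖ⟩ c = 1 := SimpleGraph.dist_eq_one_iff_adj.2 hc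
        exact ⟨hc, fun w hw hdw => hall w hw (by rw [hdw, hdc])⟩
  · -- ### THE GENERIC CASE `v ≠ r₀`: ★ J6-mult, every child passes
    have hγK : u⁻¹ * γ * u ∈ unitaryInt σ ((StdForm.antidiagonal 3).over K) := mem_unitaryInt_conj_of_latticeGraphIso_apply_root_eq hfix
    have hγϖd : ∀ i j, Valued.v ((((((u)⁻¹ * γ * (u) : unitaryGroupOfForm σ ((StdForm.antidiagonal 3).over K)) : GL (Fin 3) K) : Matrix (Fin 3) (Fin 3) K) - 1) i j) ≤ Valued.v ϖ ^ d₀ := by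
      have h := (forall_v_conj_sub_one_le_iff_map_sub_one_le_scaleLattice γ u (pow_ne_zero d₀ hϖ0)).1 hvR
      intro i j; rw [← map_pow]; exact h i j
    have hγϖ2 : ∀ i j, Valued.v ((((((u)⁻¹ * γ * (u) : unitaryGroupOfForm σ ((StdForm.antidiagonal 3).over K)) : GL (Fin 3) K) : Matrix (Fin 3) (Fin 3) K) - 1) i j) ≤ Valued.v ϖ ^ 2 :=
      fun i j => (hγϖd i j).trans (pow_le_pow_right_of_le_one' hϖ1.le (by omega))
    have hγϖ : ∀ i j, Valued.v ((((((u)⁻¹ * γ * (u) : unitaryGroupOfForm σ ((StdForm.antidiagonal 3).over K)) : GL (Fin 3) K) : Matrix (Fin 3) (Fin 3) K) - 1) i j) ≤ Valued.v ϖ :=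
      fun i j => (hγϖ2 i j).trans (by rw [sq]; exact mul_le_of_le_one_left zero_le hϖ1.le)
    have hlev := (forall_v_conj_sub_one_le_iff_map_sub_one_le_scaleLattice γ u hϖ0).2 hγϖ
    have hmain := ncard_fixedGrandchildren_sep_eq_mul_ncard_passingChildren hσ hvσ hσϖ hϖ hres h2 hT hv hvr hfix hlev (fun w => ¬ w.1.map ((Matrix.toLin' (((γ : GL (Fin 3) K) : Matrix (Fin 3) (Fin 3) K) - 1)).restrictScalars 𝒪[K]) ≤ scaleLattice (ϖ ^ d₀) w.1 ∧ P w) hQ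
    refine Eq.trans ?_ (hmain.trans ?_)
    · rfl
    · congr 1
      congr 1
      ext c
      simp only [Set.mem_setOf_eq]
      constructor
      · rintro ⟨hadj, hdc, -, hall⟩; exact ⟨hadj, hdc, hall⟩
      · rintro ⟨hadj, hdc, hall⟩
        obtain ⟨κ, hκK, hc⟩ := (mem_neighborSet_latticeGraphIso_root_iff hσ hvσ hσϖ hϖ h2 u c).1 ((SimpleGraph.mem_neighborSet _ _ _).2 hadj)
        refine ⟨hadj, hdc, fun w hw => ?_, hall⟩
        rw [hc] at hw
        exact forall_fixed_neighbor_of_congr_sq hvσ hσϖ hϖ hres hγK hκK hγϖ2 hw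

end Three

end Literature.NumberTheory.Automorphic.UnitaryLatticeTree

end
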